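import Summits.BirchSwinnertonDyer.BirchSwinnertonDyer.Theorems.PrintX8VSInputHondaSystemLayerGalois
import Summits.BirchSwinnertonDyer.Rank1Residual.Additive.KobayashiSignedGenerationDischarge
import Summits.BirchSwinnertonDyer.Rank1Residual.Additive.CyclotomicTowerSignedLocalTraceTransitive
import HarnessLib

/-!
# Traces between the `ℤ_p`-layers `ℚ_{p,n}` and Kobayashi's tower `k_n = ℚ_p(ζ_{p^{n+1}})` on local points (route `PrintX8VS` /
# `PrintX8`, support item `InputHondaSystem` = stmt-BirchSwinnertonDyer-20413, named fact `Sprung2012.thm22_exists_isHondaSystem`;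
# file 11 of the local series: the `Δ`-descent bookkeeping by which Sprung's Thm. 2.2 is read on the `ℤ_p`-tower)

HONEST FRAMING (desk `pub/bsd-wall/bsd-inputs`, seat `bsd-inputs-honda-p1`, D-0154 (2) INPUTS): THEOREMS ONLY — no definition, no
named fact, no instance, no `sorry`; Galois bookkeeping on `localPoints W ℚ_[p]`; closes nothing by itself; BSD is not proved by any
of this.

## Setting

`p` odd, `κ : ZpExtension ℚ p` cyclotomic, `ι : ℚ̄ → ℚ̄_p`, `W/ℚ`, and an antitone tower `U n ≤ κ.layerSubgroup n` of normal finite-index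
subgroups of `Γ_ℚ` whose local subgroups are `Stab(ζ_{n+1})` (`hU`; meant: `U n = Kobayashi2003.towerSubgroup κ ℚ(ζ_p) n`). Write
`L_n = κ.layerSubgroup n` (fixed points `E(ℚ_{p,n}) = localLayerPointsOfEmb κ ι W n`), `𝒟_n = Tr_{k_n/ℚ_{p,n}} =
localPairTraceOfEmb ι W L_n (U n)` (the `Δ`-trace), `Tr_{n+1/n} = localTraceOfEmb κ ι W n (n+1)`.

* §1 the `Δ`-trace through `toLoc`: on points with coordinates in `ℚ_p(ζ_{m₂})` the trace for a pair of subgroups with local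
  subgroups `Stab(ζ_{m₁}) ⊇ Stab(ζ_{m₂})` is the transported sum `∑_{q ∈ Stab(ζ_{m₁})/Stab(ζ_{m₂})} q̃ • (·)` of the `E_Ω`-side.
* §2 `𝒟_n X = (p−1)•X` on `E(ℚ_{p,n})`, `Tr_{n+1/n} X = p•X` on `E(ℚ_{p,n})` (indices from file `…LayerGalois`); the `Δ`-bijection
  `𝒟_{n+1} X = 𝒟_n X` on `E(k_n)`; `Tr_{n+1/n} ∘ 𝒟_{n+1} = 𝒟_n ∘ Tr_{k_{n+1}/k_n}` on `E(k_{n+1})`; `𝒟_n` commutes with `Γ_{ℚ_p}` and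
  maps `ℤ[Γ·X]` onto `ℤ[Γ·𝒟_n X]`.

References: [Sprung2012] F. Sprung, J. Number Theory 132 (2012), §2 p. 1486 (`G_n = Δ × Γ_n`, `k_n`, `ℚ_n`), Thm. 2.2;
[Kobayashi2003] S. Kobayashi, Invent. Math. 152 (2003), Def. 1.1, §2 p. 4 (the trace maps).
-/

set_option autoImplicit false
-- the Theorems namespace of this sub repeats the summit name by design (D-0017 nested layout)
set_option linter.dupNamespace false

noncomputable section

open scoped Classical
open Finset

namespace Summit.BirchSwinnertonDyer.BirchSwinnertonDyer.Theorems

namespace SprungHonda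

open Literature.NumberTheory.EllipticCurves Literature.NumberTheory.GaloisRepresentations
  Literature.NumberTheory.EllipticCurves.ZpExtension Literature.NumberTheory.EllipticCurves.Kobayashi2003
  Summit.BirchSwinnertonDyer.Rank1Residual.Additive Summit.BirchSwinnertonDyer.Rank1Residual.Additive.PadicCyclotomicTower
  Summit.BirchSwinnertonDyer.Rank1Residual.Additive.BallEval

variable {p : ℕ} [hp : Fact p.Prime]

/-! ## §1 The `Δ`-trace through `toLoc` -/

section ToLoc

variable {K : Type} [Field K] [Algebra K ℚ_[p]] (ι : AlgebraicClosure K →ₐ[K] AlgebraicClosure ℚ_[p]) (W : WeierstrassCurve K)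
  {M : WeierstrassCurve ℤ_[p]}

/-- **The trace for a pair `H₁ ⊇ H₂` with local subgroups `Stab(ζ_{m₁}) ⊇ Stab(ζ_{m₂})`, through `toLoc`**: on a point with
coordinates in `ℚ_p(ζ_{m₂})`, `Tr_{H₁/H₂} (toLoc Q) = toLoc (∑_{q ∈ Stab(ζ_{m₁})/Stab(ζ_{m₂})} q̃ ⋆ Q)` with the transported action
`σ ⋆ Q = toLoc⁻¹ (σ • toLoc Q)` (re-indexing the coset sum, tree `localPairTraceOfEmb_eq_sum_of_bijective`).
[cite: Kobayashi2003, §2 p. 4 (the trace maps)] -/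
theorem localPairTraceOfEmb_toLoc_eq_sum (hV : genFibΩ p M = W.baseChange (AlgebraicClosure ℚ_[p]))
    {H₁ H₂ : Subgroup (Field.absoluteGaloisGroup K)} [H₂.FiniteIndex] {m₁ m₂ : ℕ}
    (h₁ : localSubgroupOfEmb H₁ ι = stab p m₁) (h₂ : localSubgroupOfEmb H₂ ι = stab p m₂)
    [Fintype (stab p m₁ ⧸ (stab p m₂).subgroupOf (stab p m₁))] {Q : (genFibΩ p M).toAffine.Point}
    (hQ : Q ∈ subfieldPoints (genFibΩ p M) (layer p m₂).toSubfield coeffs_mem_layer) :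
    localPairTraceOfEmb ι W H₁ H₂ (toLoc hV Q) =
      toLoc hV (∑ q : stab p m₁ ⧸ (stab p m₂).subgroupOf (stab p m₁),
        (toLoc hV).symm (((q.out : stab p m₁) : Field.absoluteGaloisGroup ℚ_[p]) • toLoc hV Q)) := by
  set e := toLoc hV with he
  have hQ' : (e Q : localPoints W ℚ_[p]) ∈ localFixedPointsOfEmb ι W H₂ := by
    rw [mem_localFixedPointsOfEmb_iff]
    intro τ hτ
    rw [h₂] at hτ
    exact (forall_smul_eq_iff_mem_subfieldPoints hV m₂ (e Q)).mpr (by simpa [he] using hQ) τ hτ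
  have hmem : ∀ τ : Field.absoluteGaloisGroup ℚ_[p], τ ∈ stab p m₁ → τ ∈ localSubgroupOfEmb H₁ ι := fun τ hτ ↦ by
    rw [h₁]; exact hτ
  have hmem' : ∀ τ : Field.absoluteGaloisGroup ℚ_[p], τ ∈ localSubgroupOfEmb H₂ ι ↔ τ ∈ stab p m₂ := fun τ ↦ by rw [h₂]
  let g : (stab p m₁ ⧸ (stab p m₂).subgroupOf (stab p m₁)) → localSubgroupOfEmb H₁ ι :=
    fun q ↦ ⟨((q.out : stab p m₁) : Field.absoluteGaloisGroup ℚ_[p]), hmem _ q.out.2⟩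
  have hg : Function.Bijective fun q ↦ (QuotientGroup.mk (g q) :
      localSubgroupOfEmb H₁ ι ⧸ (localSubgroupOfEmb H₂ ι).subgroupOf (localSubgroupOfEmb H₁ ι)) := by
    constructor
    · intro q₁ q₂ hq
      have hq' := QuotientGroup.eq.mp hq
      rw [Subgroup.mem_subgroupOf, Subgroup.coe_mul, Subgroup.coe_inv, hmem'] at hq'
      rw [← QuotientGroup.out_eq' q₁, ← QuotientGroup.out_eq' q₂, QuotientGroup.eq, Subgroup.mem_subgroupOf, Subgroup.coe_mul,
        Subgroup.coe_inv]
      exact hq'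
    · intro r
      obtain ⟨τ, rfl⟩ := QuotientGroup.mk_surjective r
      have hiff : ∀ σ : Field.absoluteGaloisGroup ℚ_[p], σ ∈ localSubgroupOfEmb H₁ ι ↔ σ ∈ stab p m₁ := fun σ ↦ by rw [h₁]
      have hτ : (τ : Field.absoluteGaloisGroup ℚ_[p]) ∈ stab p m₁ := (hiff _).mp τ.2
      refine ⟨QuotientGroup.mk ⟨τ, hτ⟩, ?_⟩
      change QuotientGroup.mk (g (QuotientGroup.mk ⟨(τ : Field.absoluteGaloisGroup ℚ_[p]), hτ⟩)) = QuotientGroup.mk τ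
      rw [QuotientGroup.eq, Subgroup.mem_subgroupOf, Subgroup.coe_mul, Subgroup.coe_inv, hmem']
      obtain ⟨h, hh⟩ := QuotientGroup.mk_out_eq_mul (s := (stab p m₂).subgroupOf (stab p m₁))
        (⟨(τ : Field.absoluteGaloisGroup ℚ_[p]), hτ⟩ : stab p m₁)
      have hh' := congrArg (fun z : stab p m₁ ↦ (z : Field.absoluteGaloisGroup ℚ_[p])) hh
      simp only [Subgroup.coe_mul] at hh'
      change ((((QuotientGroup.mk (s := (stab p m₂).subgroupOf (stab p m₁))
          ⟨(τ : Field.absoluteGaloisGroup ℚ_[p]), hτ⟩).out : stab p m₁) : Field.absoluteGaloisGroup ℚ_[p]))⁻¹ *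
          τ ∈ stab p m₂
      rw [hh', mul_inv_rev, mul_assoc, inv_mul_cancel, mul_one]
      exact (stab p m₂).inv_mem (Subgroup.mem_subgroupOf.mp h.2)
  rw [localPairTraceOfEmb_eq_sum_of_bijective ι W H₁ H₂ hQ' g hg, map_sum]
  exact sum_congr rfl fun q _ ↦ by rw [he, AddEquiv.apply_symm_apply]

end ToLoc

/-! ## §2 The `Δ`-trace on the `ℤ_p`-layers -/

section Layers

variable (κ : ZpExtension ℚ p) (ι : AlgebraicClosure ℚ →ₐ[ℚ] AlgebraicClosure ℚ_[p]) (W : WeierstrassCurve ℚ)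
  (U : ℕ → Subgroup (Field.absoluteGaloisGroup ℚ))

/-- **`𝒟_n X = (p−1)•X` on `E(ℚ_{p,n})`** (`[k_n : ℚ_{p,n}] = p − 1`, file `…LayerGalois`). [cite: Sprung2012, §2 p. 1486] -/
theorem localPairTraceOfEmb_of_mem_layer [∀ n, (U n).FiniteIndex] (hp2 : p ≠ 2) (hκ : κ.IsCyclotomic)
    (hU : ∀ n, localSubgroupOfEmb (U n) ι = stab p (n + 1)) {n : ℕ} {X : localPoints W ℚ_[p]}
    (hX : X ∈ localLayerPointsOfEmb κ ι W n) :
    localPairTraceOfEmb ι W (κ.layerSubgroup n) (U n) X = (p - 1) • X := by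
  rw [localPairTraceOfEmb_apply_of_mem_lower ι W (H₂ := U n) (show X ∈ localFixedPointsOfEmb ι W (κ.layerSubgroup n) from hX),
    hU n, (index_quotientStab_and_index_localLayerSubgroup ι hp2 hκ n).1]

/-- **`Tr_{n+1/n} X = p•X` on `E(ℚ_{p,n})`** (`[ℚ_{p,n+1} : ℚ_{p,n}] = p`, file `…LayerGalois`). [cite: Sprung2012, §2 p. 1486] -/
theorem localTraceOfEmb_of_mem_layer (hp2 : p ≠ 2) (hκ : κ.IsCyclotomic) {n : ℕ} {X : localPoints W ℚ_[p]}
    (hX : X ∈ localLayerPointsOfEmb κ ι W n) : localTraceOfEmb κ ι W n (n + 1) X = p • X := by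
  rw [localTraceOfEmb_apply_of_mem_lower κ ι W n (n + 1) hX, localLayerSubgroupOfEmb, localLayerSubgroupOfEmb,
    index_localLayerSubgroup_succ_subgroupOf ι hp2 hκ n]

/-- **The `Δ`-bijection on traces**: `𝒟_{n+1} X = 𝒟_n X` for `X ∈ E(k_n)` (restriction identifies `Gal(k_{n+1}/ℚ_{p,n+1})` with
`Gal(k_n/ℚ_{p,n})`, file `…LayerGalois`). [cite: Sprung2012, §2 p. 1486 (G_n = Δ × Γ_n)] -/
theorem localPairTraceOfEmb_succ_eq [∀ n, (U n).FiniteIndex] (hp2 : p ≠ 2) (hκ : κ.IsCyclotomic)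
    (hU : ∀ n, localSubgroupOfEmb (U n) ι = stab p (n + 1)) {n : ℕ} {X : localPoints W ℚ_[p]}
    (hX : X ∈ localFixedPointsOfEmb ι W (U n)) :
    localPairTraceOfEmb ι W (κ.layerSubgroup (n + 1)) (U (n + 1)) X = localPairTraceOfEmb ι W (κ.layerSubgroup n) (U n) X := by
  haveI : Fintype (localSubgroupOfEmb (κ.layerSubgroup (n + 1)) ι ⧸
      (localSubgroupOfEmb (U (n + 1)) ι).subgroupOf (localSubgroupOfEmb (κ.layerSubgroup (n + 1)) ι)) := Fintype.ofFinite _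
  let g : (localSubgroupOfEmb (κ.layerSubgroup (n + 1)) ι ⧸
      (localSubgroupOfEmb (U (n + 1)) ι).subgroupOf (localSubgroupOfEmb (κ.layerSubgroup (n + 1)) ι)) →
      localSubgroupOfEmb (κ.layerSubgroup n) ι := fun q ↦
    ⟨((q.out : localSubgroupOfEmb (κ.layerSubgroup (n + 1)) ι) : Field.absoluteGaloisGroup ℚ_[p]),
      localLayerSubgroupOfEmb_antitone κ ι (Nat.le_succ n) q.out.2⟩
  have hg := bijective_quotientStab_map ι hp2 hκ n (hU n) (hU (n + 1))
  rw [localPairTraceOfEmb_eq_sum_of_bijective ι W (κ.layerSubgroup n) (U n) hX g hg, localPairTraceOfEmb_apply]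

/-- **`Tr_{n+1/n} ∘ 𝒟_{n+1} = 𝒟_n ∘ Tr_{k_{n+1}/k_n}` on `E(k_{n+1})`** (both are `Tr_{k_{n+1}/ℚ_{p,n}}`, transitivity of traces).
[cite: Kobayashi2003, §2 p. 4 (the trace maps)] -/
theorem localTraceOfEmb_localPairTraceOfEmb [∀ n, (U n).FiniteIndex] (hUa : Antitone U) (hUL : ∀ n, U n ≤ κ.layerSubgroup n) {n : ℕ}
    {X : localPoints W ℚ_[p]} (hX : X ∈ localFixedPointsOfEmb ι W (U (n + 1))) :
    localTraceOfEmb κ ι W n (n + 1) (localPairTraceOfEmb ι W (κ.layerSubgroup (n + 1)) (U (n + 1)) X) =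
      localPairTraceOfEmb ι W (κ.layerSubgroup n) (U n) (localPairTraceOfEmb ι W (U n) (U (n + 1)) X) := by
  rw [localTraceOfEmb_eq_localPairTraceOfEmb,
    ← localPairTraceOfEmb_trans ι W (κ.layerSubgroup_antitone (Nat.le_succ n)) (hUL (n + 1)) hX,
    localPairTraceOfEmb_trans ι W (hUL n) (hUa (Nat.le_succ n)) hX]

/-- `𝒟_n` commutes with `Γ_{ℚ_p}` on `E(k_n)` (normal subgroups). [cite: Kobayashi2003, §2 p. 4] -/
theorem smul_localPairTraceOfEmb_layer [∀ n, (U n).FiniteIndex] [∀ n, (U n).Normal] (n : ℕ) (σ : Field.absoluteGaloisGroup ℚ_[p]) {X : localPoints W ℚ_[p]}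
    (hX : X ∈ localFixedPointsOfEmb ι W (U n)) :
    σ • localPairTraceOfEmb ι W (κ.layerSubgroup n) (U n) X = localPairTraceOfEmb ι W (κ.layerSubgroup n) (U n) (σ • X) :=
  smul_localPairTraceOfEmb_of_normal ι W _ _ σ hX

/-- `𝒟_n` maps `ℤ[Γ·X]` onto `ℤ[Γ·𝒟_n X]` for `X ∈ E(k_n)`. [cite: Kobayashi2003, §2 p. 4] -/
theorem map_localPairTraceOfEmb_closure_orbit [∀ n, (U n).FiniteIndex] [∀ n, (U n).Normal] (n : ℕ) {X : localPoints W ℚ_[p]} (hX : X ∈ localFixedPointsOfEmb ι W (U n)) :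
    (AddSubgroup.closure (Set.range fun σ : Field.absoluteGaloisGroup ℚ_[p] ↦ σ • X)).map
        (localPairTraceOfEmb ι W (κ.layerSubgroup n) (U n)) =
      AddSubgroup.closure (Set.range fun σ : Field.absoluteGaloisGroup ℚ_[p] ↦
        σ • localPairTraceOfEmb ι W (κ.layerSubgroup n) (U n) X) := by
  rw [AddMonoidHom.map_closure, ← Set.range_comp]
  have h : (⇑(localPairTraceOfEmb ι W (κ.layerSubgroup n) (U n)) ∘ fun σ : Field.absoluteGaloisGroup ℚ_[p] ↦ σ • X) =
      fun σ : Field.absoluteGaloisGroup ℚ_[p] ↦ σ • localPairTraceOfEmb ι W (κ.layerSubgroup n) (U n) X :=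
    funext fun σ ↦ (smul_localPairTraceOfEmb_layer κ ι W U n σ hX).symm
  rw [h]

/-- `𝒟_n X ∈ E(ℚ_{p,n})` for `X ∈ E(k_n)`. [cite: Kobayashi2003, §2 p. 4] -/
theorem localPairTraceOfEmb_mem_layer [∀ n, (U n).FiniteIndex] (n : ℕ) {X : localPoints W ℚ_[p]} (hX : X ∈ localFixedPointsOfEmb ι W (U n)) :
    localPairTraceOfEmb ι W (κ.layerSubgroup n) (U n) X ∈ localLayerPointsOfEmb κ ι W n :=
  localPairTraceOfEmb_mem_of_mem ι W hX

/-- `E(ℚ_{p,n}) ≤ E(k_n)` (`U n ≤ L_n`). [cite: Sprung2012, §2 p. 1486 (ℚ_n ⊆ k_n)] -/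
theorem localLayerPointsOfEmb_le_localFixedPointsOfEmb (hUL : ∀ n, U n ≤ κ.layerSubgroup n) (n : ℕ) :
    localLayerPointsOfEmb κ ι W n ≤ localFixedPointsOfEmb ι W (U n) :=
  localFixedPointsOfEmb_antitone ι W (hUL n)

end Layers

end SprungHonda

end Summit.BirchSwinnertonDyer.BirchSwinnertonDyer.Theorems

end
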